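/-
Copyright: ideator seat ym-r3-idea-2 (gen 9), cell ym3-torus.  Second BC5 / tribunal-T3 WITNESS RUNG for the shared deciding crux
`RectangleTailL` (stmt-QuantumFields-23864) of the line-routes `RectangleDomination` (LINE 17) and `RandomisedStokes` (LINE 18):
thin strips `1 × b`, `b ≤ R`.  Nothing is claimed beyond what the kernel checks below; no summit, rung of the ladder or crux is proved here.
-/
import Summits.QuantumFields.YangMills.Theorems.RectangleDominationRectangleTailLRung
import Literature.MathematicalPhysics.QuantumFieldTheory.Balaban1983to89.TorusHypercubicSymmetry

/-!
# `RectangleTailL` — the thin-strip rung `1 × b`, `b ≤ R` (BC5 witness no. 2, tribunal T3 «then thin rectangles»)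

The `1 × 1` rung (`RectangleDominationRectangleTailLRung.rectangleTailL_rung_one_one`) identified the smallest rectangular holonomy
with the plaquette variable.  THIS FILE adds the deterministic STRIP STOKES RECURRENCE (the `i = 0` instance of the geometric half of
the `RectangleDomination` lever):
`hol ∂([x,x+e_μ]×[x,x+(b+1)e_ν]) = hol ∂([x,x+e_μ]×[x,x+b e_ν]) · W_b⁻¹ · C_b · W_b`,
`W_b = hol(x+b e_ν → x)` the straight transport, `C_b = U(y,μ)U(y+e_μ,ν)U(y+e_ν,μ)⁻¹U(y,ν)⁻¹` the unit cell at `y = x + b e_ν`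
(`pathHol_rectLoop_one_succ`), hence by `|gh−1| ≤ |g−1|+|h−1|` and conjugation invariance (B7 (19))
`dist1(hol ∂(1×b)) ≤ Σ_{k<b} dist1(U(∂p_k))` (`dist1_pathHol_rectLoop_one_le_sum`; either orientation, the cell being a plaquette
variable or its inverse), and then the union bound with the tree's Peierls–chessboard single-plaquette tail gives the body of
`RectangleTailL` VERBATIM with `1 ≤ a → 1 ≤ b` replaced by `a = 1 → 1 ≤ b → b ≤ R`, constants `α = 1`, `c = 1/(4R)`, `C = 2e^{24}c₀⁻³`,
`A = 5` (`rectangleTailL_rung_strip`).  For `R = 1` this is the `1 × 1` rung again.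

WHY THIS IS A WITNESS AND NOT THE CRUX: the union bound pays `t ↦ t/b` per plaquette, i.e. the exponent `β t²/(4b²)`; the crux wants
`β t²/((1+b)(1+log(1+b)))` UNIFORMLY in `b`, which the union bound delivers only for bounded `b ≤ R` (constant `c = 1/(4R)`).  Closing the gap
`b² ↝ b log b` for unbounded strips already needs the multi-scale decorrelation of the plaquette fluxes along the strip — the open content of
the crux (not in print for non-abelian `d = 3`; locator note LIT-LINE6).

References: [FrohlichIsraelLiebSimon1978] Thm 4.1; [Balaban1985UV3] (11) p.258, (71) p.273; [Balaban1985Averaging] (9), (19); [ChatterjeeYMProb2019] §4.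
-/

noncomputable section

open MeasureTheory
open Literature.MathematicalPhysics.QuantumFieldTheory.Balaban1983to89
open Literature.MathematicalPhysics.QuantumFieldTheory.Balaban1983to89.T3ContinuumYM3Torus
open Literature.MathematicalPhysics.QuantumFieldTheory.Balaban1983to89.T3UnitScaleTilt
open Literature.MathematicalPhysics.QuantumFieldTheory.Balaban1983to89.T3UnitLawDensityEML
open Literature.MathematicalPhysics.QuantumFieldTheory.Balaban1983to89.Missing
open Summit.QuantumFields.YangMills.Theorems

namespace Summit.QuantumFields.YangMills.Theorems.RectangleDominationRectangleTailLStripRung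

/-! ## 1. Strip Stokes: the deterministic recurrence in `b` -/

section Loop

variable {P : Params} {G : Type*} [GaugeGroup G]

/-- The backward straight segment has the inverse holonomy of the forward one: `hol(x+n e_ν → x) = hol(x → x+n e_ν)⁻¹`. [folklore] -/
theorem pathHol_bwdSeg_eq_inv (U : GaugeField P 0 G) (x : Site P 0) (ν : Fin P.d) :
    ∀ n : ℕ, pathHol U (bwdSeg x ν n) = (pathHol U (fwdSeg x ν n))⁻¹
  | 0 => by simp [bwdSeg, fwdSeg]
  | n + 1 => by
    rw [bwdSeg, fwdSeg, pathHol_cons, pathHol_append, pathHol_bwdSeg_eq_inv U x ν n, pathHol_cons, pathHol_nil]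
    simp [mul_inv_rev]

/-- Commuting a unit move past a move: `(x + e_μ) + b e_ν = (x + b e_ν) + e_μ`. [folklore] -/
theorem shift_move_comm (x : Site P 0) (μ ν : Fin P.d) (b : ℕ) : (x.shift μ).move ν b = (x.move ν b).shift μ := by
  rw [← Site.move_one, Site.move_comm, Site.move_one]

/-- **STRIP STOKES RECURRENCE.**  Growing the thin rectangle `[x, x+e_μ] × [x, x+b e_ν]` by one cell in direction `ν` multiplies its
holonomy (based at the corner `x`) on the right by the corner-transported unit cell at `y = x + b e_ν`:
`hol ∂(1×(b+1)) = hol ∂(1×b) · (W_b⁻¹ · U(y,μ)U(y+e_μ,ν)U(y+e_ν,μ)⁻¹U(y,ν)⁻¹ · W_b)`, `W_b = hol(x + b e_ν → x)`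
(the lattice non-abelian Stokes formula for a strip, one cell at a time). [cite: Balaban1985Averaging, (9) p.19] -/
theorem pathHol_rectLoop_one_succ (U : GaugeField P 0 G) (x : Site P 0) (μ ν : Fin P.d) (b : ℕ) :
    pathHol U (rectLoop x μ ν 1 (b + 1)) = pathHol U (rectLoop x μ ν 1 b) *
      ((pathHol U (bwdSeg x ν b))⁻¹ *
        (U ⟨x.move ν b, μ⟩ * U ⟨(x.move ν b).shift μ, ν⟩ * (U ⟨(x.move ν b).shift ν, μ⟩)⁻¹ * (U ⟨x.move ν b, ν⟩)⁻¹) *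
        pathHol U (bwdSeg x ν b)) := by
  have h2 : x.move ν (b + 1) = (x.move ν b).shift ν := Site.move_succ x ν b
  simp only [rectLoop, fwdSeg, bwdSeg, Site.move_zero, Site.move_one, shift_move_comm, h2, List.nil_append,
    List.append_assoc, List.cons_append, pathHol_append, pathHol_cons, pathHol_bwdSeg_eq_inv, Bool.false_eq_true,
    if_true, if_false]
  group

/-- **`dist1(hol ∂(1×b)) ≤ Σ_{k<b} dist1(cell_k)`**: subadditivity `|gh − 1| ≤ |g − 1| + |h − 1|` and conjugation invariance of
`dist1` (B7 (19)) along the strip recurrence; `b = 0` is the degenerate loop `U(x,μ)U(x,μ)⁻¹ = 1`. [cite: Balaban1985Averaging, (19) p.21] -/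
theorem dist1_pathHol_rectLoop_one_le_sum (U : GaugeField P 0 G) (x : Site P 0) (μ ν : Fin P.d) :
    ∀ b : ℕ, dist1 (pathHol U (rectLoop x μ ν 1 b)) ≤ ∑ k ∈ Finset.range b,
      dist1 (U ⟨x.move ν k, μ⟩ * U ⟨(x.move ν k).shift μ, ν⟩ * (U ⟨(x.move ν k).shift ν, μ⟩)⁻¹ * (U ⟨x.move ν k, ν⟩)⁻¹)
  | 0 => by
    simp [rectLoop, fwdSeg, bwdSeg, pathHol_cons, GaugeGroup.dist1_one]
  | b + 1 => by
    rw [pathHol_rectLoop_one_succ, Finset.sum_range_succ]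
    refine (GaugeGroup.dist1_mul_le _ _).trans (add_le_add (dist1_pathHol_rectLoop_one_le_sum U x μ ν b) (le_of_eq ?_))
    have h := GaugeGroup.dist1_conj
      (U ⟨x.move ν b, μ⟩ * U ⟨(x.move ν b).shift μ, ν⟩ * (U ⟨(x.move ν b).shift ν, μ⟩)⁻¹ * (U ⟨x.move ν b, ν⟩)⁻¹)
      (pathHol U (bwdSeg x ν b))⁻¹
    simpa using h

/-- The unit cell `U(y,μ)U(y+e_μ,ν)U(y+e_ν,μ)⁻¹U(y,ν)⁻¹` is the plaquette variable `U(∂⟨y,μ,ν⟩)` if `μ < ν` and the INVERSE plaquette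
variable `U(∂⟨y,ν,μ⟩)⁻¹` if `ν < μ`; either way its `dist1` is that of a plaquette variable. [cite: Balaban1985Averaging, (9) p.19] -/
theorem exists_plaq_dist1_cell (y : Site P 0) {μ ν : Fin P.d} (hμν : μ ≠ ν) :
    ∃ p : Plaq P 0, ∀ U : GaugeField P 0 G,
      dist1 (U ⟨y, μ⟩ * U ⟨y.shift μ, ν⟩ * (U ⟨y.shift ν, μ⟩)⁻¹ * (U ⟨y, ν⟩)⁻¹) = dist1 (GaugeField.plaqHol U p) := by
  rcases lt_or_gt_of_ne hμν with h | h
  · exact ⟨⟨y, μ, ν, h⟩, fun U => rfl⟩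
  · refine ⟨⟨y, ν, μ, h⟩, fun U => ?_⟩
    rw [← GaugeGroup.dist1_inv (GaugeField.plaqHol U _)]
    congr 1
    simp [GaugeField.plaqHol, mul_inv_rev, mul_assoc]

/-- **The strip tail event lies in a union of `b` single-plaquette tail events at threshold `t/b`** (`b ≥ 1`). [folklore] -/
theorem setOf_rectLoop_one_subset (x : Site P 0) {μ ν : Fin P.d} (hμν : μ ≠ ν) {b : ℕ} (hb : 1 ≤ b) (t : ℝ) :
    ∃ p : ℕ → Plaq P 0, {U : GaugeField P 0 G | t ≤ dist1 (pathHol U (rectLoop x μ ν 1 b))} ⊆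
      ⋃ k ∈ Finset.range b, {U | t / b ≤ dist1 (GaugeField.plaqHol U (p k))} := by
  choose p hp using fun k : ℕ => exists_plaq_dist1_cell (G := G) (x.move ν k) hμν
  refine ⟨p, fun U hU => ?_⟩
  simp only [Set.mem_setOf_eq] at hU
  simp only [Set.mem_iUnion, Set.mem_setOf_eq, Finset.mem_range, exists_prop]
  by_contra hall
  push Not at hall
  have hb0 : (0 : ℝ) < b := by exact_mod_cast hb
  have hlt : ∑ k ∈ Finset.range b, dist1 (GaugeField.plaqHol U (p k)) < ∑ _k ∈ Finset.range b, t / b :=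
    Finset.sum_lt_sum_of_nonempty ⟨0, Finset.mem_range.2 hb⟩ fun k hk => hall k (Finset.mem_range.1 hk)
  rw [Finset.sum_const, Finset.card_range, nsmul_eq_mul, mul_div_cancel₀ _ hb0.ne'] at hlt
  have hle := dist1_pathHol_rectLoop_one_le_sum U x μ ν b
  simp only [hp] at hle
  linarith

end Loop

/-! ## 2. The rung -/

/-- **`RectangleTailL` ON THIN STRIPS `1 × b`, `b ≤ R` (BC5 witness no. 2).**  The body of `Theses.RectangleDomination.RectangleTailL` with
`1 ≤ a → 1 ≤ b` specialised to `a = 1 → 1 ≤ b → b ≤ R`, constants `α = 1`, `c = 1/(4R)`, `C = 2e^{24}c₀⁻³`, `A = 5`: for every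
`T3Family F`, `0 < γ ≤ 1`, run `K`, corner `x`, directions `μ ≠ ν`, `1 ≤ b ≤ R` and `0 < t ≤ 1`,
`Gibbs_K{t ≤ dist1(hol ∂rect_{1×b})} ≤ C β_K^5 (1+b)^5 exp(−c t² β_K/((1+b)(1+log(1+b))))`.
Strip Stokes (§1) + union bound + the tree's chessboard single-plaquette tail at threshold `t/b` + `β_K ≥ 1`; uniform in the volume and
the cut-off, NOT uniform in `R` (`c = 1/(4R)` — the `b² ↝ b·log b` gap is the open crux). [cite: FrohlichIsraelLiebSimon1978, Thm. 4.1; Balaban1985UV3, (11) p.258 and (71) p.273] -/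
theorem rectangleTailL_rung_strip : ∀ (L R : ℕ), 1 ≤ R → ∃ (α c C : ℝ) (A : ℕ), 0 < α ∧ 0 < c ∧ 0 ≤ C ∧
    ∀ (F : T3Family) (γ : ℝ), F.L = L → 0 < γ → γ ≤ 1 →
      ∀ (K a b : ℕ) (x : Site (F.P K) 0) (μ ν : Fin (F.P K).d) (t : ℝ), μ ≠ ν → a = 1 → 1 ≤ b → b ≤ R →
        2 * (a + b) < (F.P K).sitesPerDir 0 → 0 < t → t ≤ 1 →
          (gibbsK F ℰp γ K).real {U | t ≤ dist1 (pathHol U (rectLoop x μ ν a b))} ≤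
            C * (F.scheme ℰp γ).β K ^ A * ((a : ℝ) + b) ^ A *
              Real.exp (-((c * (t ^ 2 * (F.scheme ℰp γ).β K / (((a : ℝ) + b) * (1 + Real.log ((a : ℝ) + b))))) ^ α)) := by
  obtain ⟨c₀, hc₀, _, h⟩ := T3FinestHeightTail.gibbsMeasure_real_dist1_ge_le (N := 2)
  intro L R hR
  have hR0 : (0 : ℝ) < R := by exact_mod_cast hR
  refine ⟨1, 1 / (4 * R), 2 * Real.exp 24 * (c₀ ^ 3)⁻¹, 5, one_pos, by positivity, by positivity, ?_⟩
  intro F γ _ hγ hγ1 K a b x μ ν t hμν ha hb hbR _ ht _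
  subst ha
  -- `β_K = (γ ε_K)⁻¹ ≥ 1` for `0 < γ ≤ 1`
  have hβ1 : 1 ≤ (F.scheme ℰp γ).β K := by
    have hL1 : (1 : ℝ) ≤ (F.L : ℝ) := by exact_mod_cast F.hL.2.le
    have hLK : (1 : ℝ) ≤ (F.L : ℝ) ^ K := one_le_pow₀ hL1
    have hβ : (F.scheme ℰp γ).β K = (γ * ((F.L : ℝ)⁻¹) ^ K)⁻¹ := rfl
    rw [hβ, inv_pow]
    have hx0 : 0 < γ * ((F.L : ℝ) ^ K)⁻¹ := by positivity
    have hx1 : γ * ((F.L : ℝ) ^ K)⁻¹ ≤ 1 := by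
      calc γ * ((F.L : ℝ) ^ K)⁻¹ ≤ 1 * 1 := by gcongr; exact inv_le_one_of_one_le₀ hLK
        _ = 1 := one_mul 1
    exact one_le_inv_iff₀.mpr ⟨hx0, hx1⟩
  rw [gibbsK_eq]
  set β : ℝ := (F.scheme ℰp γ).β K with hβdef
  have hβ0 : 0 ≤ β := zero_le_one.trans hβ1
  haveI := T4GenFunBounds.isProbabilityMeasure_gibbsMeasure (G := Matrix.specialUnitaryGroup (Fin 2) ℂ) (F.P K) hβ0
  -- strip Stokes + union bound
  obtain ⟨p, hsub⟩ := setOf_rectLoop_one_subset (G := Matrix.specialUnitaryGroup (Fin 2) ℂ) x hμν hb t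
  have hb0 : (0 : ℝ) < b := by exact_mod_cast hb
  have htb : 0 ≤ t / b := div_nonneg ht.le hb0.le
  have hcard : Fintype.card {q : Fin (F.P K).d × Fin (F.P K).d // q.1 < q.2} = 3 := by
    rw [show (F.P K).d = 3 from rfl]; decide
  have hd3 : (F.P K).d = 3 := rfl
  -- each summand: the chessboard tail at threshold `t/b`
  have hterm : ∀ k ∈ Finset.range b,
      (T4GenFunBounds.gibbsMeasure (F.P K) β).real
          {U : GaugeField (F.P K) 0 (Matrix.specialUnitaryGroup (Fin 2) ℂ) | t / b ≤ dist1 (GaugeField.plaqHol U (p k))} ≤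
        2 * Real.exp 24 * (c₀ ^ 3)⁻¹ * Real.sqrt β ^ 9 * Real.exp (-(β * (t / b) ^ 2 / 4)) := by
    intro k _
    have h1 := h (F.P K) β hβ1 (t / b) htb (p k)
    rw [hcard, hd3] at h1
    have h8 : Real.exp (8 * (3 : ℕ)) = Real.exp 24 := by norm_num
    have h9 : 3 * (2 ^ 2 - 1) = 9 := by norm_num
    have h4 : (2 : ℝ) * ((2 : ℕ) : ℝ) = 4 := by norm_num
    rw [h8, h9, h4] at h1
    exact h1
  have hunion : (T4GenFunBounds.gibbsMeasure (F.P K) β).real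
        {U : GaugeField (F.P K) 0 (Matrix.specialUnitaryGroup (Fin 2) ℂ) | t ≤ dist1 (pathHol U (rectLoop x μ ν 1 b))} ≤
      (b : ℝ) * (2 * Real.exp 24 * (c₀ ^ 3)⁻¹ * Real.sqrt β ^ 9 * Real.exp (-(β * (t / b) ^ 2 / 4))) := by
    refine ((measureReal_mono hsub (measure_ne_top _ _)).trans (measureReal_biUnion_finset_le _ _)).trans ?_
    refine (Finset.sum_le_sum hterm).trans ?_
    rw [Finset.sum_const, Finset.card_range, nsmul_eq_mul]
  refine hunion.trans ?_
  -- arithmetic: `b ≤ (1+b)^5`, `(√β)^9 ≤ β^5`, and the exponent comparison `b² ≤ R(1+b)(1+log(1+b))`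
  have hsq : Real.sqrt β ^ 9 ≤ β ^ 5 := LargeFieldMassRefinementTail.sqrt_pow_nine_le_pow_five hβ1
  have hab : ((1 : ℕ) : ℝ) + (b : ℝ) = 1 + b := by norm_num
  rw [hab, Real.rpow_one]
  have hb1 : (1 : ℝ) ≤ 1 + b := by linarith
  have hlog : 0 ≤ Real.log (1 + (b : ℝ)) := Real.log_nonneg hb1
  have hden : 0 < (1 + (b : ℝ)) * (1 + Real.log (1 + (b : ℝ))) := by positivity
  -- exponent comparison
  have hexp : Real.exp (-(β * (t / b) ^ 2 / 4)) ≤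
      Real.exp (-(1 / (4 * R) * (t ^ 2 * β / ((1 + (b : ℝ)) * (1 + Real.log (1 + (b : ℝ))))))) := by
    rw [Real.exp_le_exp, neg_le_neg_iff]
    have hbR' : (b : ℝ) ≤ R := by exact_mod_cast hbR
    -- `b² ≤ R (1+b)(1+log(1+b))`
    have hkey : (b : ℝ) ^ 2 ≤ R * ((1 + (b : ℝ)) * (1 + Real.log (1 + (b : ℝ)))) := by
      have h1' : (b : ℝ) ^ 2 ≤ R * (1 + b) := by nlinarith
      have h2' : (R : ℝ) * (1 + b) ≤ R * ((1 + (b : ℝ)) * (1 + Real.log (1 + (b : ℝ)))) := by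
        have : (1 + (b : ℝ)) ≤ (1 + (b : ℝ)) * (1 + Real.log (1 + (b : ℝ))) := by nlinarith
        exact mul_le_mul_of_nonneg_left this hR0.le
      exact h1'.trans h2'
    rw [div_pow]
    -- compare `(1/(4R)) · t²β / D ≤ β t² / (4 b²)` via `b² ≤ R·D`
    have ht2 : 0 ≤ t ^ 2 * β := by positivity
    calc 1 / (4 * R) * (t ^ 2 * β / ((1 + (b : ℝ)) * (1 + Real.log (1 + (b : ℝ)))))
        = t ^ 2 * β / (4 * (R * ((1 + (b : ℝ)) * (1 + Real.log (1 + (b : ℝ)))))) := by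
          field_simp
      _ ≤ t ^ 2 * β / (4 * (b : ℝ) ^ 2) := by
          apply div_le_div_of_nonneg_left ht2 (by positivity)
          nlinarith
      _ = β * (t ^ 2 / (b : ℝ) ^ 2) / 4 := by ring
  have hC : 0 ≤ 2 * Real.exp 24 * (c₀ ^ 3)⁻¹ := by positivity
  have hbpow : (b : ℝ) ≤ (1 + (b : ℝ)) ^ 5 := by
    calc (b : ℝ) ≤ 1 + b := by linarith
      _ ≤ (1 + (b : ℝ)) ^ 5 := le_self_pow₀ hb1 (by norm_num)
  calc (b : ℝ) * (2 * Real.exp 24 * (c₀ ^ 3)⁻¹ * Real.sqrt β ^ 9 * Real.exp (-(β * (t / b) ^ 2 / 4)))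
      = 2 * Real.exp 24 * (c₀ ^ 3)⁻¹ * Real.sqrt β ^ 9 * (b : ℝ) * Real.exp (-(β * (t / b) ^ 2 / 4)) := by ring
    _ ≤ 2 * Real.exp 24 * (c₀ ^ 3)⁻¹ * β ^ 5 * (1 + (b : ℝ)) ^ 5 *
          Real.exp (-(1 / (4 * R) * (t ^ 2 * β / ((1 + (b : ℝ)) * (1 + Real.log (1 + (b : ℝ))))))) := by
        gcongr

end Summit.QuantumFields.YangMills.Theorems.RectangleDominationRectangleTailLStripRung
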